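import Summits.QuantumFields.QCD.Theorems.SpectralDefectExtinctionWegnerEstimateCoareaCircleArea
import Summits.QuantumFields.QCD.Theorems.SpectralDefectExtinctionWegnerEstimateStubCircleZeroCount

/-!
# Single-link resonance (S2c of line `corner-decorrelation-deep-hole`): the phase matrix of a unitary and
the area bound for `3 × 3` trigonometric Hermitian families
(crux `Summit.QuantumFields.QCD.Theses.SpectralDefectExtinction.WindowExtinction`, item stmt-QuantumFields-18063)

Brick D of the registered stub `stub_singleLinkResonance`.  The resonance event of S2c — "the plaquette
holonomy `Y = ρ(U_P) ∈ U(3)` has a characteristic root within `ε` of `e^{iφ₀}`" — is controlled through the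
`3 × 3` HERMITIAN PHASE MATRIX

  `S = (−i/2)(a Y − ā Yᴴ)`,  `a = e^{−iφ₀}`

(the matrix of the rigidity lemma `cornerSL_point_rigidity`), whose spectrum is `{Im(a σ) : σ ∈ spec Y}`:

* `cornerSL_phase_isHermitian` — `S` is Hermitian;
* `cornerSL_phase_resonance` — if `Y` is unitary and has a characteristic root `w` with `‖w − e^{iφ₀}‖ ≤ ε`
  then `S` has an eigenvalue (one of Mathlib's `eigenvalues j`) of modulus `≤ ε`;
* `cornerSL_trigFamily_areaBound` — for ANY `3 × 3` Hermitian family of the form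
  `H(s) = H₀ + cos s H₁ + sin s H₂` (the phase matrix along a one-link circle is of this form) and every
  `ε > 0`, the AREA BOUND `Σ_i ∫_{[0,2π]} |Λ_i'(t)| φ_ε(Λ_i(t)) dt ≤ 4656 π` for the sorted eigenvalues and
  the window `φ_ε(E) = ε/(E² + ε²)`: level sets are met at most `6` times per period
  (`stub_circleZeroCount` with `B = C = 1`), multiplicity `≤ 3`, so the landed abstract count
  `coareaWegner_levelCount_of_crossings` and the 1-D area inequality
  `coareaWegner_lintegral_deriv_mul_le_crossings` apply verbatim (constants of the Wegner line kept).
-/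

noncomputable section

namespace Summit.QuantumFields.QCD.Cruxes.WindowExtinction.CornerDecorrelationDeepHole

open scoped BigOperators Matrix ENNReal NNReal ComplexConjugate ComplexOrder
open Matrix MeasureTheory
open Summit.QuantumFields.QCD.Cruxes.WegnerEstimate.ResolventCell

/-! ### The phase matrix of a unitary -/

/-- The phase matrix `(−i/2)(a Y − ā Yᴴ)` is Hermitian. -/
theorem cornerSL_phase_isHermitian (Y : Matrix (Fin 3) (Fin 3) ℂ) (a : ℂ) :
    ((-Complex.I / 2) • (a • Y - (starRingEnd ℂ a) • Yᴴ)).IsHermitian := by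
  refine Matrix.IsHermitian.ext fun i j => ?_
  simp only [Matrix.smul_apply, Matrix.sub_apply, Matrix.conjTranspose_apply, smul_eq_mul, Complex.star_def,
    map_mul, map_sub, map_div₀, map_neg, Complex.conj_I, Complex.conj_conj, map_ofNat]
  ring

/-- **Resonance capture.**  If a unitary `Y` has a characteristic root `w` with `‖w − e^{iφ₀}‖ ≤ ε`, then
the phase matrix `S = (−i/2)(e^{−iφ₀} Y − e^{iφ₀} Yᴴ)` has an eigenvalue of modulus `≤ ε`
(namely `Im(e^{−iφ₀} w)`, on the `w`-eigenvector of the normal matrix `Y`). -/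
theorem cornerSL_phase_resonance (Y : Matrix (Fin 3) (Fin 3) ℂ) (hY : Y ∈ Matrix.unitaryGroup (Fin 3) ℂ)
    (φ₀ ε : ℝ) (w : ℂ) (hw : w ∈ Y.charpoly.roots)
    (hwε : ‖w - Complex.exp (↑φ₀ * Complex.I)‖ ≤ ε)
    (hS : ((-Complex.I / 2) • (Complex.exp (-(φ₀ * Complex.I)) • Y -
      (starRingEnd ℂ (Complex.exp (-(φ₀ * Complex.I)))) • Yᴴ)).IsHermitian) :
    ∃ j, |hS.eigenvalues j| ≤ ε := by
  set a : ℂ := Complex.exp (-(φ₀ * Complex.I)) with ha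
  have haconj : starRingEnd ℂ a = Complex.exp (↑φ₀ * Complex.I) := by
    rw [ha, ← Complex.exp_conj, map_neg, map_mul, Complex.conj_ofReal, Complex.conj_I, mul_neg, neg_neg]
  have hanorm : ‖a‖ = 1 := by
    rw [ha, show -(↑φ₀ * Complex.I) = ((-φ₀ : ℝ) : ℂ) * Complex.I by push_cast; ring,
      Complex.norm_exp_ofReal_mul_I]
  have haa : a * starRingEnd ℂ a = 1 := by
    rw [Complex.mul_conj, Complex.normSq_eq_norm_sq, hanorm]; simp
  -- an eigenvector of `Y` for `w`
  have hroot : Y.charpoly.eval w = 0 := (Polynomial.mem_roots (Matrix.charpoly_monic Y).ne_zero).1 hw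
  have hdet : (w • (1 : Matrix (Fin 3) (Fin 3) ℂ) - Y).det = 0 := by
    rw [Matrix.eval_charpoly, Matrix.scalar_apply] at hroot
    rw [Matrix.smul_one_eq_diagonal]
    exact hroot
  obtain ⟨v, hv0, hv⟩ := Matrix.exists_mulVec_eq_zero_iff.2 hdet
  have hYv : Y *ᵥ v = w • v := by
    rw [Matrix.sub_mulVec, Matrix.smul_mulVec, Matrix.one_mulVec, sub_eq_zero] at hv
    exact hv.symm
  -- `Y` unitary: `‖w‖ = 1` and `Yᴴ v = w̄ v`
  have hYu : Yᴴ * Y = 1 := Matrix.mem_unitaryGroup_iff'.mp hY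
  have hYhv : Yᴴ *ᵥ (Y *ᵥ v) = v := by rw [Matrix.mulVec_mulVec, hYu, Matrix.one_mulVec]
  have hnormv : star v ⬝ᵥ (Yᴴ *ᵥ (Y *ᵥ v)) = star (Y *ᵥ v) ⬝ᵥ (Y *ᵥ v) := by
    rw [Matrix.dotProduct_mulVec, ← Matrix.star_mulVec]
  have hvv0 : star v ⬝ᵥ v ≠ 0 := by
    rw [Ne, dotProduct_star_self_eq_zero]
    exact hv0
  have hw1 : starRingEnd ℂ w * w = 1 := by
    have h1 : star (Y *ᵥ v) ⬝ᵥ (Y *ᵥ v) = star v ⬝ᵥ v := by rw [← hnormv, hYhv]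
    rw [hYv, star_smul, smul_dotProduct, dotProduct_smul, smul_smul, smul_eq_mul, Complex.star_def] at h1
    have h2 : (starRingEnd ℂ w * w - 1) * (star v ⬝ᵥ v) = 0 := by rw [sub_mul, one_mul, h1, sub_self]
    rcases mul_eq_zero.1 h2 with h | h
    · exact sub_eq_zero.1 h
    · exact absurd h hvv0
  have hYhv' : Yᴴ *ᵥ v = (starRingEnd ℂ w) • v := by
    have h := hYhv
    rw [hYv, Matrix.mulVec_smul] at h
    -- `w • Yᴴ v = v` ⇒ `Yᴴ v = w̄ v` since `w̄ w = 1`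
    have h3 : Yᴴ *ᵥ v = (starRingEnd ℂ w) • (w • (Yᴴ *ᵥ v)) := by
      rw [smul_smul, hw1, one_smul]
    rw [h3, h]
  -- `S v = Im(a w) v`
  set s : ℝ := (a * w).im with hs
  have hSv : ((-Complex.I / 2) • (a • Y - (starRingEnd ℂ a) • Yᴴ)) *ᵥ v = (s : ℂ) • v := by
    rw [Matrix.smul_mulVec, Matrix.sub_mulVec, Matrix.smul_mulVec, Matrix.smul_mulVec, hYv, hYhv',
      smul_smul, smul_smul, ← sub_smul, smul_smul]
    congr 1
    have : starRingEnd ℂ a * starRingEnd ℂ w = starRingEnd ℂ (a * w) := by rw [map_mul]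
    rw [this, Complex.sub_conj, hs]
    push_cast
    ring_nf
    rw [Complex.I_sq]
    ring
  -- hence `s` is an eigenvalue of `S`
  have hdetS : (((-Complex.I / 2) • (a • Y - (starRingEnd ℂ a) • Yᴴ)) -
      ((s : ℝ) : ℂ) • (1 : Matrix (Fin 3) (Fin 3) ℂ)).det = 0 := by
    rw [← Matrix.exists_mulVec_eq_zero_iff]
    exact ⟨v, hv0, by rw [Matrix.sub_mulVec, hSv, Matrix.smul_mulVec, Matrix.one_mulVec, sub_self]⟩
  obtain ⟨j, hj⟩ := coareaWegner_exists_eigenvalues_eq_of_det hS hdetS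
  refine ⟨j, ?_⟩
  rw [hj, hs]
  -- `|Im(a w)| = |Im(a (w − ā))| ≤ ‖a‖ ‖w − ā‖ ≤ ε`
  have h1 : (a * w).im = (a * (w - starRingEnd ℂ a)).im := by
    rw [mul_sub, Complex.sub_im, haa]; simp
  rw [h1]
  calc |(a * (w - starRingEnd ℂ a)).im| ≤ ‖a * (w - starRingEnd ℂ a)‖ := Complex.abs_im_le_norm _
    _ = ‖w - starRingEnd ℂ a‖ := by rw [norm_mul, hanorm, one_mul]
    _ ≤ ε := by rw [haconj]; exact hwε

/-! ### The area bound for `3 × 3` trigonometric Hermitian families -/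

/-- Level crossings of a `3 × 3` trigonometric Hermitian family: every level is flat or met at most `6`
(hence `≤ 48`) times per period (`stub_circleZeroCount` with `N = r = 3`, `B = C = 1`). -/
theorem cornerSL_trigFamily_crossings (Hs : ℝ → Matrix (Fin 3) (Fin 3) ℂ) (H₀ H₁ H₂ : Matrix (Fin 3) (Fin 3) ℂ)
    (hfam : ∀ s, Hs s = H₀ + ((Real.cos s : ℝ) : ℂ) • H₁ + ((Real.sin s : ℝ) : ℂ) • H₂) (E : ℝ) :
    (∀ t : ℝ, (Hs t - ((E : ℝ) : ℂ) • (1 : Matrix (Fin 3) (Fin 3) ℂ)).det = 0) ∨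
      ({t : ℝ | t ∈ Set.Ico (0 : ℝ) (2 * Real.pi) ∧
          (Hs t - ((E : ℝ) : ℂ) • (1 : Matrix (Fin 3) (Fin 3) ℂ)).det = 0}.Finite ∧
        {t : ℝ | t ∈ Set.Ico (0 : ℝ) (2 * Real.pi) ∧
          (Hs t - ((E : ℝ) : ℂ) • (1 : Matrix (Fin 3) (Fin 3) ℂ)).det = 0}.ncard ≤ 48) := by
  have hshape : ∀ t : ℝ, Hs t - ((E : ℝ) : ℂ) • (1 : Matrix (Fin 3) (Fin 3) ℂ) =
      (-(((E : ℝ) : ℂ) • (1 : Matrix (Fin 3) (Fin 3) ℂ))) +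
        1 * (H₀ + ((Real.cos t : ℝ) : ℂ) • H₁ + ((Real.sin t : ℝ) : ℂ) • H₂) * 1 := by
    intro t
    rw [Matrix.one_mul, Matrix.mul_one, hfam t]
    abel
  simp only [hshape]
  rcases stub_circleZeroCount 3 3 (-(((E : ℝ) : ℂ) • (1 : Matrix (Fin 3) (Fin 3) ℂ))) 1 1 H₀ H₁ H₂ with h0 | ⟨hfin, hcard⟩
  · exact Or.inl h0
  · exact Or.inr ⟨hfin, hcard.trans (by norm_num)⟩

/-- **The area bound for `3 × 3` trigonometric Hermitian families.**  For `H(s) = H₀ + cos s H₁ + sin s H₂`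
Hermitian and `ε > 0`: `Σ_i ∫⁻_{[0,2π]} |Λ_i'(t)| · ε/(Λ_i(t)² + ε²) dt ≤ 4656 π` for the sorted
eigenvalues `Λ_i`. -/
theorem cornerSL_trigFamily_areaBound (Hs : ℝ → Matrix (Fin 3) (Fin 3) ℂ) (hH : ∀ s, (Hs s).IsHermitian)
    (H₀ H₁ H₂ : Matrix (Fin 3) (Fin 3) ℂ)
    (hfam : ∀ s, Hs s = H₀ + ((Real.cos s : ℝ) : ℂ) • H₁ + ((Real.sin s : ℝ) : ℂ) • H₂)
    {ε : ℝ} (hε : 0 < ε) :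
    ∑ i : Fin (Fintype.card (Fin 3)), ∫⁻ t in Set.Icc 0 (2 * Real.pi),
      ENNReal.ofReal (|deriv (fun s => (hH s).eigenvalues₀ i) t| *
        (ε / ((hH t).eigenvalues₀ i ^ 2 + ε ^ 2))) ≤ ENNReal.ofReal (4656 * Real.pi) := by
  set Λ : Fin (Fintype.card (Fin 3)) → ℝ → ℝ := fun i s => (hH s).eigenvalues₀ i with hΛ
  set φ : ℝ → ℝ := fun E => ε / (E ^ 2 + ε ^ 2) with hφ
  have hφc : Continuous φ := by
    refine continuous_const.div (by fun_prop) fun E => ?_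
    positivity
  have hφ0 : ∀ E, 0 ≤ φ E := fun E => by positivity
  set Ncount : Fin (Fintype.card (Fin 3)) → ℝ → ℝ≥0∞ := fun i E =>
    (({s : ℝ | s ∈ Set.Icc 0 (2 * Real.pi + 2 * Real.pi) ∧ Λ i s = E}.encard : ENat) : ENNReal) with hN
  -- Lipschitz
  have hK : ∀ i, LipschitzWith (Fintype.card (Fin 3) * ∑ p' : Fin 3, ∑ q' : Fin 3, (‖H₁ p' q'‖₊ + ‖H₂ p' q'‖₊))
      (fun s => (hH s).eigenvalues₀ i) := fun i =>
    coareaWegner_eigenvalues₀_lipschitz _ hH (fun s t p q => by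
      rw [hfam s, hfam t]; exact coareaWegner_trigFamily_lipschitz_const H₀ H₁ H₂ s t p q) i
  -- periodicity and level count
  have hper : ∀ s, Hs (s + 2 * Real.pi) = Hs s := fun s => by
    rw [hfam, hfam, Real.cos_add_two_pi, Real.sin_add_two_pi]
  have hmult : ∀ (E : ℝ) (s t' : ℝ), (Hs t' - ((E : ℝ) : ℂ) • (1 : Matrix (Fin 3) (Fin 3) ℂ)).det ≠ 0 →
      Fintype.card {j : Fin 3 // (hH s).eigenvalues j = E} ≤ 24 := fun E s t' _ =>
    (Fintype.card_subtype_le _).trans (by simp)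
  obtain ⟨F, hFfin, hcount⟩ := coareaWegner_levelCount_of_crossings Hs hH hper
    (cornerSL_trigFamily_crossings Hs H₀ H₁ H₂ hfam) hmult
  -- each sorted eigenvalue: the 1-D area inequality
  have hJ : ∀ i, ∫⁻ t in Set.Icc 0 (2 * Real.pi), ENNReal.ofReal (|deriv (Λ i) t| * φ (Λ i t)) ≤
      2 * ∫⁻ E, ENNReal.ofReal (φ E) * Ncount i E := fun i =>
    coareaWegner_lintegral_deriv_mul_le_crossings (hK i) hφc hφ0 Real.two_pi_pos.le Real.two_pi_pos
  -- the summed count, off the finite set `F`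
  have hae : ∀ᵐ E : ℝ, ∑ i, ENNReal.ofReal (φ E) * Ncount i E ≤ ENNReal.ofReal (φ E) * 2328 := by
    have hnull : volume F = 0 := hFfin.measure_zero volume
    rw [ae_iff]
    refine measure_mono_null (fun E hE => ?_) hnull
    by_contra hEF
    refine hE ?_
    rw [← Finset.mul_sum]
    exact mul_le_mul' le_rfl (hcount E hEF)
  calc ∑ i, ∫⁻ t in Set.Icc 0 (2 * Real.pi), ENNReal.ofReal (|deriv (Λ i) t| * φ (Λ i t))
      ≤ ∑ i, 2 * ∫⁻ E, ENNReal.ofReal (φ E) * Ncount i E := Finset.sum_le_sum fun i _ => hJ i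
    _ = 2 * ∑ i, ∫⁻ E, ENNReal.ofReal (φ E) * Ncount i E := by rw [Finset.mul_sum]
    _ ≤ 2 * ∫⁻ E, ∑ i, ENNReal.ofReal (φ E) * Ncount i E :=
        mul_le_mul' le_rfl (coareaWegner_sum_lintegral_le _ _ _)
    _ ≤ 2 * ∫⁻ E, ENNReal.ofReal (φ E) * 2328 := mul_le_mul' le_rfl (lintegral_mono_ae hae)
    _ = 2 * (2328 * ∫⁻ E, ENNReal.ofReal (φ E)) := by
        rw [lintegral_mul_const' _ _ (by norm_num), mul_comm (∫⁻ E, ENNReal.ofReal (φ E)) 2328]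
    _ = 2 * (2328 * ENNReal.ofReal Real.pi) := by rw [coareaWegner_lintegral_window hε]
    _ = ENNReal.ofReal (4656 * Real.pi) := by
        rw [← mul_assoc, ENNReal.ofReal_mul (by norm_num)]
        norm_num

end Summit.QuantumFields.QCD.Cruxes.WindowExtinction.CornerDecorrelationDeepHole

end
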